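import Summits.BirchSwinnertonDyer.BirchSwinnertonDyer.Theorems.ShaPrimaryTransferFiniteShaComponentTransferDoorAtSeven
import Summits.BirchSwinnertonDyer.BirchSwinnertonDyer.Theorems.Rank1ResidualIntModelReduction
import Summits.BirchSwinnertonDyer.Rank1Residual.Additive.PointCountEulerNat
import Literature.NumberTheory.EllipticCurves.Rank1Residual.X11RankOneCertificates.Minimality
import Literature.NumberTheory.EllipticCurves.OrdinaryPrimesProofs
import HarnessLib

/-!
# The door at `7` docks with X2 directly: `7` is good ordinary (anomalous) for `E_{−8/5}`, so X2 alone gives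
# `ord_{s=1} L(E_{−8/5}, s) ≤ 2`

Helper for item **stmt-BirchSwinnertonDyer-22356** (`FiniteShaComponentTransfer`, «T») of route `ShaPrimaryTransfer`
(`--supports … --as helper`); it closes nothing, and **BSD is NOT proved by this file**. The doors at `2` and `3` open
`O` at primes where KatoTransfer's X2/X3 (stmt-18412/18413: good ORDINARY `p ≥ 5`) cannot dock, so the transfer `T`
is needed to move `t_{p₀} = 0` to an admissible prime (`…RowAtFive`: `p₀ = 2 → q = 5` on `E_{659,12}`). The door at
`7` needs no transfer: a Kubert–Tate `7`-torsion curve with `7 ∤ Δ` reduces at `7` to a curve with a point of order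
`7`, so `#Ẽ(𝔽₇) = 7`, `a₇ = 1` — `7` is good, ordinary and anomalous. For the rank-`2` instance
`E₂ = E_{−8/5} = [−79, 4160, 104000, 0, 0]` (`…DoorAtSeven`: `rank = 2`, `t₇ = 0`, `s₇ = 2`, all unconditional):

* `isGloballyMinimal_E₂` — the equation is globally minimal (`Δ = −2²¹·5⁷·13⁷·3947`, `c₄ = 720724161 = 3·43·251·22259`
  is prime to `Δ`; Silverman VII.1 Rem. 1.1 via the tree's `isGloballyMinimal_of_int_criterion`);
* `card_seven_E₂ : #Ẽ₂(𝔽₇) = 7`, `frobeniusTrace_seven_E₂ : a₇(E₂) = 1`, `goodOrdinary_seven_E₂`;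
* **`analyticRank_E₂_le_two_of_X2 : AnalyticRankLeSelmerCorank → ord_{s=1} L(E₂, s) ≤ 2`** — X2 at its own
  admissible prime `p = 7` and the unconditional `s₇(E₂) = 2`; NO transfer hypothesis (contrast `…RowAtFive`).

## References

* [SilvermanAEC2009] J. H. Silverman, *AEC*, 2nd ed., VII.1 Rem. 1.1, VII.5 Prop. 5.1(a), V.2, X.4.
* [Fisher2001FiveSevenDescent] T. Fisher, JEMS 3 (2001), §§1–2.
* [GreenbergLNM1716] R. Greenberg, LNM 1716 (1999), §1 (pp. 54–57).
-/

-- D-0017: single-problem summit, so `Summit.BirchSwinnertonDyer.BirchSwinnertonDyer.…` repeats a namespace BY DESIGN.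
set_option linter.dupNamespace false

noncomputable section

namespace Summit.BirchSwinnertonDyer.BirchSwinnertonDyer.Theorems.ShaPrimaryTransferRowAtSeven

open scoped Classical
open Literature.NumberTheory.EllipticCurves
open Literature.NumberTheory.EllipticCurves.Rank1Residual.X11RankOneCertificates
  (isGloballyMinimal_of_int_criterion discOf c4Of)
open WeierstrassCurve
open Summit.BirchSwinnertonDyer.BirchSwinnertonDyer.Rank1Residual
open Summit.BirchSwinnertonDyer.Rank1Residual.Additive
open Summit.BirchSwinnertonDyer.BirchSwinnertonDyer.Theses.ShaPrimaryTransfer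
  (FiniteShaComponentTransfer AnalyticRankLeSelmerCorank)
open Summit.BirchSwinnertonDyer.BirchSwinnertonDyer.Theorems.ShaPrimaryTransferDoorAtSeven
  (shaCorank_seven_E₂ mordellWeilRank_E₂ selmerCorank_seven_E₂)

/-! ## §1 The equation `[−79, 4160, 104000, 0, 0]` is globally minimal -/

/-- `Δ([−79, 4160, 104000, 0, 0]) = −40577990098780160000000 = −2²¹·5⁷·13⁷·3947`. [cite: SilvermanAEC2009, III.1] -/
theorem discOf_E₂ : discOf [-79, 4160, 104000, 0, 0] = -40577990098780160000000 := by
  decide +kernel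

/-- `c₄([−79, 4160, 104000, 0, 0]) = 720724161 = 3·43·251·22259`. [cite: SilvermanAEC2009, III.1] -/
theorem c4Of_E₂ : c4Of [-79, 4160, 104000, 0, 0] = 720724161 := by
  decide +kernel

/-- `gcd(c₄, Δ) = 1` for `E₂`. [folklore] -/
theorem gcd_c4_disc_E₂ : Int.gcd 720724161 (-40577990098780160000000) = 1 := by
  decide +kernel

/-- **`[−79, 4160, 104000, 0, 0]` is a global minimal equation**: no prime `q` has `q¹² ∣ Δ` and `q⁴ ∣ c₄`, since
`gcd(c₄, Δ) = 1` (Silverman VII.1 Rem. 1.1, tree `isGloballyMinimal_of_int_criterion`). [cite: SilvermanAEC2009, VII.1 Rem. 1.1] -/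
theorem isGloballyMinimal_lit : (⟨-79, 4160, 104000, 0, 0⟩ : WeierstrassCurve ℚ).IsGloballyMinimal := by
  have h := isGloballyMinimal_of_int_criterion (-79) 4160 104000 0 0 fun q hq hdvd => by
    rw [discOf_E₂, c4Of_E₂] at hdvd
    obtain ⟨h12, h4⟩ := hdvd
    have hqΔ : (q : ℤ) ∣ -40577990098780160000000 := (dvd_pow_self (q : ℤ) (by norm_num)).trans h12
    have hqc : (q : ℤ) ∣ 720724161 := (dvd_pow_self (q : ℤ) (by norm_num)).trans h4
    have hg : (q : ℤ) ∣ (Int.gcd 720724161 (-40577990098780160000000) : ℤ) := Int.dvd_coe_gcd hqc hqΔ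
    rw [gcd_c4_disc_E₂] at hg
    have h1 : (q : ℤ) ≤ 1 := Int.le_of_dvd one_pos hg
    have h2 : (2 : ℤ) ≤ q := by exact_mod_cast hq.two_le
    omega
  simpa only [Int.cast_neg, Int.cast_ofNat, Int.cast_zero] using h

/-- … hence `E_{−8/5}` (the tree's `kubertTateSeven (−8) 5`) is globally minimal. [cite: SilvermanAEC2009, VII.1 Rem. 1.1] -/
theorem isGloballyMinimal_E₂ : (kubertTateSeven (((-8 : ℤ) : ℚ)) (((5 : ℤ) : ℚ))).IsGloballyMinimal := by
  rw [KubertTateM85Descent.curve_eq]; exact isGloballyMinimal_lit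

/-- The tree's integral model of the globally minimal `E₂` is `[−79, 4160, 104000, 0, 0]`. [cite: SilvermanAEC2009, VIII.8] -/
theorem intModel_E₂ [(kubertTateSeven (((-8 : ℤ) : ℚ)) (((5 : ℤ) : ℚ))).IsGloballyMinimal] :
    integralModelInt (kubertTateSeven (((-8 : ℤ) : ℚ)) (((5 : ℤ) : ℚ))) = ⟨-79, 4160, 104000, 0, 0⟩ :=
  IntModel.integralModelInt_eq_of_map_eq _ (by rw [IntModel.map_mk_int, KubertTateM85Descent.curve_eq]; ext <;> norm_num)

/-! ## §2 `7` is good ordinary (anomalous) for `E₂`: `#Ẽ₂(𝔽₇) = 7`, `a₇ = 1` -/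

/-- `#Ẽ₂(𝔽₇) = 7` (the reduction `y² + 5xy + y = x³ + 2x²` over `𝔽₇`; kernel-decided). [folklore] -/
theorem card_seven_E₂ :
    Nat.card (((⟨-79, 4160, 104000, 0, 0⟩ : WeierstrassCurve ℤ).map (Int.castRingHom (ZMod 7))).toAffine.Point)
      = 7 := by
  rw [PointCountNat.natCard_point_map_eq (hℓ := ⟨by norm_num⟩) (by norm_num) (-79) 4160 104000 0 0
    (by decide +kernel)]
  decide +kernel

/-- **`a₇(E₂) = 1`** (`7 + 1 − 7`): `7` is ordinary and ANOMALOUS for `E₂`, as for every Kubert–Tate `7`-torsion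
curve with good reduction at `7` (the point of order `7` survives reduction). [folklore] -/
theorem frobeniusTrace_seven_E₂ :
    haveI : Fact (Nat.Prime 7) := ⟨by norm_num⟩
    haveI := isGloballyMinimal_E₂
    (kubertTateSeven (((-8 : ℤ) : ℚ)) (((5 : ℤ) : ℚ))).frobeniusTrace 7 = 1 := by
  haveI : Fact (Nat.Prime 7) := ⟨by norm_num⟩
  haveI := isGloballyMinimal_E₂
  rw [IntModel.frobeniusTrace_eq intModel_E₂ card_seven_E₂]
  norm_num

/-- **`7` is a prime of good ordinary reduction of `E₂`**: `7 ∤ Δ_min(E₂) = −2²¹·5⁷·13⁷·3947` and `7 ∤ a₇ = 1`.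
UNCONDITIONAL. [cite: SilvermanAEC2009, VII.5 Prop. 5.1 (a)] -/
theorem goodOrdinary_seven_E₂ :
    haveI : Fact (Nat.Prime 7) := ⟨by norm_num⟩
    haveI := isGloballyMinimal_E₂
    (kubertTateSeven (((-8 : ℤ) : ℚ)) (((5 : ℤ) : ℚ))).HasGoodReductionAtPrime 7 ∧
      ¬ ((7 : ℕ) : ℤ) ∣ (kubertTateSeven (((-8 : ℤ) : ℚ)) (((5 : ℤ) : ℚ))).frobeniusTrace 7 := by
  haveI : Fact (Nat.Prime 7) := ⟨by norm_num⟩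
  haveI := isGloballyMinimal_E₂
  refine ⟨hasGoodReductionAtPrime_of_not_dvd _ 7 ?_, ?_⟩
  · rw [IntModel.minimalDiscriminantInt_eq intModel_E₂]
    decide +kernel
  · rw [frobeniusTrace_seven_E₂]
    decide

/-- `7` is good ordinary for `E₂` in the `IsOrdinaryAt` packaging of the `p`-adic `L`-function files (X3's
hypothesis shape). [cite: SilvermanAEC2009, VII.5 Prop. 5.1 (a)] -/
theorem isOrdinaryAt_seven_E₂ :
    haveI : Fact (Nat.Prime 7) := ⟨by norm_num⟩
    haveI := isGloballyMinimal_E₂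
    IsOrdinaryAt (kubertTateSeven (((-8 : ℤ) : ℚ)) (((5 : ℤ) : ℚ))) 7 :=
  goodOrdinary_seven_E₂

/-! ## §3 X2 at its own door prime: `r_an(E₂) ≤ 2` from X2 alone -/

/-- **X2 at `p = 7` on `E₂`, no transfer**: granting KatoTransfer's X2 = `AnalyticRankLeSelmerCorank` (stmt-18412), at
the good ordinary prime `7` of the globally minimal `E₂`, `ord_{s=1} L(E₂, s) ≤ s₇(E₂) = 2 = rank E₂(ℚ)` — the
`≤` half of BSD-rank for this rank-`2` curve; the door prime `7` is itself admissible for X2/X3, so `T` is not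
invoked (unlike the doors at `2`, `3`). CONDITIONAL on `hX2` only. [cite: GreenbergLNM1716, §1 (pp. 54–57)] -/
theorem analyticRank_E₂_le_two_of_X2 (hX2 : AnalyticRankLeSelmerCorank) :
    haveI := KubertTateM85Descent.isElliptic
    (kubertTateSeven (((-8 : ℤ) : ℚ)) (((5 : ℤ) : ℚ))).analyticRank ≤ 2 := by
  haveI := KubertTateM85Descent.isElliptic
  haveI : Fact (Nat.Prime 7) := ⟨by norm_num⟩
  haveI := isGloballyMinimal_E₂
  have hgo := goodOrdinary_seven_E₂
  have h := hX2 (kubertTateSeven (((-8 : ℤ) : ℚ)) (((5 : ℤ) : ℚ))) 7 (by norm_num) hgo.1 hgo.2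
  rw [selmerCorank_seven_E₂] at h
  exact h

/-- **X2 reads `r_an(E₂) ≤ rank E₂(ℚ)`** (the BSD inequality `ord_{s=1} L ≤ r_MW` for `E₂`, from X2 alone).
[cite: GreenbergLNM1716, §1 (pp. 54–57)] -/
theorem analyticRank_E₂_le_mordellWeilRank_of_X2 (hX2 : AnalyticRankLeSelmerCorank) :
    haveI := KubertTateM85Descent.isElliptic
    (kubertTateSeven (((-8 : ℤ) : ℚ)) (((5 : ℤ) : ℚ))).analyticRank ≤
      (kubertTateSeven (((-8 : ℤ) : ℚ)) (((5 : ℤ) : ℚ))).mordellWeilRank := by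
  haveI := KubertTateM85Descent.isElliptic
  rw [mordellWeilRank_E₂]
  exact analyticRank_E₂_le_two_of_X2 hX2

end Summit.BirchSwinnertonDyer.BirchSwinnertonDyer.Theorems.ShaPrimaryTransferRowAtSeven

end
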